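import Mathlib
import Literature.NumberTheory.GaloisRepresentations.PseudocharacterTaylorProofs
import Literature.NumberTheory.GaloisRepresentations.GaloisRep

/-!
# Trace limits III — uniform limits of traces are traces (Taylor's pseudocharacter theorem), and
# the limit lemma of the endo-removal step modulo matched convergence of ONE component
# (route `PhantomRMYoshida`, crux `ResiduallyYoshidaLifting` = stmt-Langlands-13639, line
# `endoscopic-crossing-euler`, Stub 4)

Companion of `…TraceLimit.lean`, `…TraceLimitEndo.lean` (`--supports stmt-Langlands-13639`).
The endo-removal step of Stub 4 `stub_weightTwoClassicality` was reduced there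
(`stub_endoRemovalModuloLimit`) to the LIMIT LEMMA "if `tr ρ` is a uniform `p`-adic limit of
endoscopic traces `tr r'_n = tr a_n + tr d_n` (`a_n, d_n : Γ_ℚ → GL₂(ℚ̄_p)` continuous) then
`tr ρ = tr r₁ + tr r₂` for some continuous `r₁, r₂`".  This file proves the limit lemma MODULO the
matched convergence of one endoscopic component (`stub_endoOfComponentLimit`): if moreover the
traces `tr a_n` of the first components converge uniformly to SOME function `t : Γ_ℚ → ℚ̄_p`, then
`ρ` is endoscopic.  Ingredients, all proved here over tree vocabulary and valid for any topological
group `G` in place of `Γ_ℚ`: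

* `isPseudocharacter_trace` — `tr ∘ r` is a pseudocharacter of dimension `n`
  (tree `Rouquier1996_prop_3_1_trace_holds`);
* `exists_framedRep_trace_eq_of_continuousPseudocharacter` — **Taylor's theorem, continuous `p`-adic
  form WITHOUT a field-of-definition clause**: every continuous pseudocharacter
  `T : G → ℚ̄_p` of dimension `n` is the trace of a continuous `r : G → GL_n(ℚ̄_p)` (tree
  `Hida2000_thm_2_18_1_holds` = Taylor's algebraic theorem, continuity by Taylor's trace formula
  `continuous_of_isSemisimple_of_continuous_trace`, framing `ContinuousRep.frame`; the tree's
  `BellaicheChenevier2009_continuous_rep_of_pseudocharacter_holds` asks for values in a finite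
  `E/ℚ_p`, which a limit of traces need not visibly have);
* `exists_framedRep_of_uniform_limit` — **a uniform `p`-adic limit of traces of continuous
  `n`-dimensional representations is the trace of one** (limits of pseudocharacters are
  pseudocharacters, tree `IsPseudocharacter.of_tendsto`; uniform limits of continuous maps are
  continuous);
* `endo_of_tendsto_component` / `stub_endoOfComponentLimit` — the limit lemma modulo matched
  convergence: the second components then converge to `tr ρ - t` (ultrametric inequality), and both
  limits are traces of continuous 2-dimensional representations.

What is NOT here (the residue of the endo-removal step): the matched convergence itself — that the
decompositions `tr r'_n = tr a_n + tr d_n` can be chosen with `tr a_n` uniformly Cauchy.  At a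
residually multiplicity-free point `σ̄ ⊕ σ̄'` (`σ̄ ≇ σ̄'` irreducible) this is the uniqueness /
closedness of the reducible locus of pseudo-deformations (Bellaïche–Chenevier, Astérisque 324,
Prop. 1.5.1; Chenevier's determinants for `p ≤ 4`), not in the tree.

References: R. Taylor, Duke Math. J. 63 (1991) §1 Thm 1; H. Hida, *Modular forms and Galois
cohomology* (2000) Thm 2.18; J. Bellaïche, G. Chenevier, Astérisque 324 (2009) §1.5, §4.2.2.
-/

noncomputable section

open Filter Topology
open scoped Matrix

namespace Summit.Langlands.Langlands.Cruxes.ResiduallyYoshidaLifting.EndoscopicCrossingEuler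

set_option linter.dupNamespace false

open Literature.NumberTheory.GaloisRepresentations

section Taylor

variable {p : ℕ} [Fact p.Prime]
variable {G : Type} [Group G] [TopologicalSpace G] [IsTopologicalGroup G] {n : ℕ}

omit [IsTopologicalGroup G] in
/-- The trace of a continuous representation `r : G → GL_n(A)` is a pseudocharacter of dimension `n`
(Frobenius / Rouquier 1996, Prop. 3.1; tree `Rouquier1996_prop_3_1_trace_holds`). [folklore] -/
theorem isPseudocharacter_trace {A : Type} [CommRing A] [TopologicalSpace A] (r : FramedRep G A n) :
    IsPseudocharacter (fun g => ((r g : GL (Fin n) A) : Matrix (Fin n) (Fin n) A).trace) n :=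
  Rouquier1996_prop_3_1_trace_holds G A n r.toMonoidHom

/-- **Taylor's theorem, continuous `p`-adic form, no field-of-definition clause.**  Every
continuous pseudocharacter `T : G → ℚ̄_p` of dimension `n` of a topological group is the trace of a
continuous representation `r : G → GL_n(ℚ̄_p)`: Taylor's algebraic theorem
(tree `Hida2000_thm_2_18_1_holds`) gives a semisimple `ρ` on `ℚ̄_pⁿ` with `tr ρ = T`; it is
continuous by Taylor's trace formula `ρ(g) = ∑ⱼ T(g gⱼ) Fⱼ`
(tree `continuous_of_isSemisimple_of_continuous_trace`), and is framed in the standard basis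
(tree `ContinuousRep.frame`). [cite: Taylor1991, §1 Theorem 1] -/
theorem exists_framedRep_trace_eq_of_continuousPseudocharacter
    (T : ContinuousPseudocharacter G (PadicAlgCl p) n) :
    ∃ r : FramedRep G (PadicAlgCl p) n,
      ∀ g, ((r g : GL (Fin n) (PadicAlgCl p)) : Matrix (Fin n) (Fin n) (PadicAlgCl p)).trace = T g := by
  classical
  obtain ⟨ρ, hss, htr⟩ := Hida2000_thm_2_18_1_holds G (PadicAlgCl p) n ⇑T T.isPseudocharacter
  have hcont : Continuous fun q : G × (Fin n → PadicAlgCl p) => ρ q.1 q.2 := by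
    refine continuous_of_isSemisimple_of_continuous_trace ρ hss
      (fun f => LinearMap.continuous_on_pi f) ?_
    simp only [htr]
    exact T.continuous
  let ρc : ContinuousRep G (PadicAlgCl p) (Fin n → PadicAlgCl p) := ⟨ρ, hcont⟩
  refine ⟨ρc.frame (Pi.basisFun (PadicAlgCl p) (Fin n)), fun g => ?_⟩
  rw [ContinuousRep.coe_frame_apply, ← LinearMap.trace_eq_matrix_trace]
  exact htr g

/-- `p⁻ᵐ → 0`. [folklore] -/
theorem tendsto_zpow_neg_natCast_nhds_zero :
    Tendsto (fun m : ℕ => (p : ℝ) ^ (-(m : ℤ))) atTop (𝓝 0) := by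
  have h1 : (1 : ℝ) < p := by exact_mod_cast (Fact.out : p.Prime).one_lt
  have : (fun m : ℕ => (p : ℝ) ^ (-(m : ℤ))) = fun m : ℕ => ((p : ℝ)⁻¹) ^ m := by
    funext m
    rw [zpow_neg, zpow_natCast, inv_pow]
  rw [this]
  exact tendsto_pow_atTop_nhds_zero_of_lt_one (inv_nonneg.mpr (zero_le_one.trans h1.le))
    (inv_lt_one_of_one_lt₀ h1)

/-- **A uniform `p`-adic limit of traces of continuous representations is the trace of a continuous
representation.**  If `a_m : G → GL_n(ℚ̄_p)` are continuous and `‖tr a_m(g) - t(g)‖ ≤ p⁻ᵐ` for all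
`m`, `g`, then `t = tr r` for a continuous `r : G → GL_n(ℚ̄_p)`: `t` is a pointwise limit of the
pseudocharacters `tr a_m`, hence a pseudocharacter of dimension `n`
(tree `IsPseudocharacter.of_tendsto`), and a uniform limit of continuous maps, hence continuous;
conclude by Taylor's theorem (`exists_framedRep_trace_eq_of_continuousPseudocharacter`).
[cite: Taylor1991, §1 Theorem 1] -/
theorem exists_framedRep_of_uniform_limit (a : ℕ → FramedRep G (PadicAlgCl p) n)
    (t : G → PadicAlgCl p)
    (ht : ∀ (m : ℕ) (g : G), ‖((a m g : GL (Fin n) (PadicAlgCl p)) :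
      Matrix (Fin n) (Fin n) (PadicAlgCl p)).trace - t g‖ ≤ (p : ℝ) ^ (-(m : ℤ))) :
    ∃ r : FramedRep G (PadicAlgCl p) n,
      ∀ g, ((r g : GL (Fin n) (PadicAlgCl p)) : Matrix (Fin n) (Fin n) (PadicAlgCl p)).trace = t g := by
  set F : ℕ → G → PadicAlgCl p := fun m g =>
    ((a m g : GL (Fin n) (PadicAlgCl p)) : Matrix (Fin n) (Fin n) (PadicAlgCl p)).trace with hF
  -- pointwise convergence, hence `t` is a pseudocharacter of dimension `n`
  have hpt : Tendsto F atTop (𝓝 t) := by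
    rw [tendsto_pi_nhds]
    intro g
    rw [tendsto_iff_norm_sub_tendsto_zero]
    exact squeeze_zero (fun m => norm_nonneg _) (fun m => ht m g) tendsto_zpow_neg_natCast_nhds_zero
  have hps : IsPseudocharacter t n :=
    IsPseudocharacter.of_tendsto (Eventually.of_forall fun m => isPseudocharacter_trace (a m)) hpt
  -- uniform convergence, hence `t` is continuous
  have hunif : TendstoUniformly F t atTop := by
    rw [Metric.tendstoUniformly_iff]
    intro ε hε
    obtain ⟨N, hN⟩ := (tendsto_order.1 (tendsto_zpow_neg_natCast_nhds_zero (p := p))).2 ε hε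
      |>.exists_forall_of_atTop
    refine eventually_atTop.mpr ⟨N, fun m hm g => ?_⟩
    rw [dist_comm, dist_eq_norm]
    exact (ht m g).trans_lt (hN m hm)
  have hcont : Continuous t :=
    hunif.continuous (Frequently.of_forall fun m => (a m).continuous_trace)
  exact exists_framedRep_trace_eq_of_continuousPseudocharacter ⟨t, hps, hcont⟩

end Taylor

/-! ### The limit lemma of the endo-removal step, modulo matched convergence of one component -/

section Endo

variable {p : ℕ} [Fact p.Prime]

/-- **Limit of endoscopic traces with one convergent component is endoscopic.**  Let
`ρ : Γ_ℚ → GL₄(ℚ̄_p)` be continuous and suppose that for every `n` there are continuous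
`r'_n : Γ_ℚ → GL₄(ℚ̄_p)`, `a_n, d_n : Γ_ℚ → GL₂(ℚ̄_p)` with `tr r'_n = tr a_n + tr d_n` (`r'_n` is
endoscopic), `‖tr r'_n - tr ρ‖_∞ ≤ p⁻ⁿ`, AND `‖tr a_n - t‖_∞ ≤ p⁻ⁿ` for a fixed function `t`.  Then
`ρ` is endoscopic: `tr ρ = tr r₁ + tr r₂` for continuous `r₁, r₂ : Γ_ℚ → GL₂(ℚ̄_p)` — namely the
representations attached by Taylor's theorem to the uniform limits `t` of `tr a_n` and `tr ρ - t` of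
`tr d_n` (`exists_framedRep_of_uniform_limit`). [folklore] -/
theorem endo_of_tendsto_component (ρ : FramedGaloisRep ℚ (PadicAlgCl p) 4)
    (t : Field.absoluteGaloisGroup ℚ → PadicAlgCl p)
    (h : ∀ n : ℕ, ∃ (r' : FramedGaloisRep ℚ (PadicAlgCl p) 4)
        (r₁ r₂ : FramedGaloisRep ℚ (PadicAlgCl p) 2),
      (∀ g, (r' g).val.trace = (r₁ g).val.trace + (r₂ g).val.trace) ∧
      (∀ g, ‖(r' g).val.trace - (ρ g).val.trace‖ ≤ (p : ℝ) ^ (-(n : ℤ))) ∧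
      ∀ g, ‖(r₁ g).val.trace - t g‖ ≤ (p : ℝ) ^ (-(n : ℤ))) :
    ∃ r₁ r₂ : FramedGaloisRep ℚ (PadicAlgCl p) 2,
      ∀ g, (ρ g).val.trace = (r₁ g).val.trace + (r₂ g).val.trace := by
  choose r' a d hsum hρ ht using h
  -- the second components converge uniformly to `t' = tr ρ - t`
  set t' : Field.absoluteGaloisGroup ℚ → PadicAlgCl p := fun g => (ρ g).val.trace - t g with ht'def
  have ht' : ∀ (n : ℕ) (g : Field.absoluteGaloisGroup ℚ),
      ‖(d n g).val.trace - t' g‖ ≤ (p : ℝ) ^ (-(n : ℤ)) := by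
    intro n g
    have hdec : (d n g).val.trace - t' g =
        ((r' n g).val.trace - (ρ g).val.trace) - ((a n g).val.trace - t g) := by
      rw [ht'def, hsum n g]
      ring
    rw [hdec, sub_eq_add_neg]
    refine (IsUltrametricDist.norm_add_le_max _ _).trans (max_le (hρ n g) ?_)
    rw [norm_neg]
    exact ht n g
  obtain ⟨r₁, hr₁⟩ := exists_framedRep_of_uniform_limit a t ht
  obtain ⟨r₂, hr₂⟩ := exists_framedRep_of_uniform_limit d t' ht'
  refine ⟨r₁, r₂, fun g => ?_⟩
  rw [hr₁ g, hr₂ g, ht'def]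
  ring

/-- **Registered sub-goal `stub_endoOfComponentLimit` of Stub 4** (the statement through which this
helper file lands, `--supports stmt-Langlands-13639`; = `endo_of_tendsto_component` in closed form):
the limit lemma `hlim` of `stub_endoRemovalModuloLimit` holds as soon as the first endoscopic
components of the approximants can be chosen with uniformly convergent traces. [folklore] -/
theorem stub_endoOfComponentLimit :
    ∀ (p : ℕ) [Fact p.Prime]
      (ρ : Literature.NumberTheory.GaloisRepresentations.FramedGaloisRep ℚ (PadicAlgCl p) 4)
      (t : Field.absoluteGaloisGroup ℚ → PadicAlgCl p),
      (∀ n : ℕ, ∃ (r' : Literature.NumberTheory.GaloisRepresentations.FramedGaloisRep ℚ (PadicAlgCl p) 4)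
          (r₁ r₂ : Literature.NumberTheory.GaloisRepresentations.FramedGaloisRep ℚ (PadicAlgCl p) 2),
        (∀ g, (r' g).val.trace = (r₁ g).val.trace + (r₂ g).val.trace) ∧
        (∀ g, ‖(r' g).val.trace - (ρ g).val.trace‖ ≤ (p : ℝ) ^ (-(n : ℤ))) ∧
        ∀ g, ‖(r₁ g).val.trace - t g‖ ≤ (p : ℝ) ^ (-(n : ℤ))) →
      ∃ r₁ r₂ : Literature.NumberTheory.GaloisRepresentations.FramedGaloisRep ℚ (PadicAlgCl p) 2,
        ∀ g, (ρ g).val.trace = (r₁ g).val.trace + (r₂ g).val.trace :=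
  fun _ _ ρ t h => endo_of_tendsto_component ρ t h

end Endo

end Summit.Langlands.Langlands.Cruxes.ResiduallyYoshidaLifting.EndoscopicCrossingEuler

end
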